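import Summits.QuantumFields.BalabanUV.T4Continuum.Support.VariationalVectorFederbush

/-!
# T⁴ programme, spine node NE2 (U1a), lane P2 — SUPPLIER LEAF V-FED, file 2: THE COVARIANT FEDERBUSH INEQUALITY FOR THE CURL FORM OF `E`-VALUED
# 1-FORMS under the line-indexed transported average `QvL`, ADDITIVE FORM — the sums of squares (lattice units; one block step, every torus)
# (`t4/skeletons/NE2-t4-ne2-p2.md` v0.14 §2.E row V-FED; cell `pub-balaban`)

NE2 formalisation swarm `b2b-balaban-t4-ne2-formalise-*`, leaf prover 01 GEN 5 (`prover-b2b-balaban-t4-ne2-formalise-leaf-01-g5-0`); file 2 of the V-FED line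
(journal INTENT CLAIMS.log 2026-08-20 11:03Z), on top of file 1 `VariationalVectorFederbush` (carriers `misL`∕`pathL`, the exact decomposition `curlV_QvL_eq`,
the pointwise bound `norm_curlV_QvL_le`) and the scalar leaf's ℝ-side (`VariationalCovariantFederbush.{sq_sum_le_card_mul, sum_blocks_translate, sum_sq_add_le,
sum_fin_sq_add_le}`) BY NAME (finite Minkowski is `sum_sq_add_le` at `m = 1`, used inline).

THE STATEMENT (row V-FED; model level; letters of file 1).  Block side `n`, coarse torus `Tor M`, fine torus `Tor (fine n M)`, fine 1-form `W`, coarse bond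
transports `Rc`, fine bond transports `R′` (`‖R′‖ ≤ 1`), line transports `T(y,j,t,μ)` (`‖T‖ ≤ 1`), (M1) across-block line mismatch `‖misL‖ ≤ m`, (M2) in-block
comb defect `‖pathL(s,t;μ,ν) − pathL(t,s;ν,μ)‖ ≤ w′`.  THEN
 * **`sum_sq_curlV_QvL_le`** (per ordered plane): `Σ_y ‖curl_{Rc}(Q_T W)(y,μ,ν)‖² ≤ ( √(n²·C′_{μν}∕n^d) + (2m + 2n·w′)·√(Y∕n^d) )²`,
   `C′_{μν} = Σ_x‖curl_{R′}W(x,μ,ν)‖²`, `Y = nsqV W = Σ_{x,μ}‖W(x,μ)‖²`;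
 * **`curlSq_QvL_le`** (summed over ordered planes): `curlSq Rc (Q_T W) ≤ ( √(n²·curlSq R′ W∕n^d) + d·(2m + 2n·w′)·√(Y∕n^d) )²`.
MAIN TERM CONSTANT EXACTLY 1 — at `m = w′ = 0` (flat data) the tree's U = 1 theorem `B5AverageCurlStokes.sum_normSq_plaq_QvOp_le` (`n^d Σ_y|plaq(Q_kA)|² ≤
n² Σ_x|plaq A|²`, [Federbush1986PhaseCellI] (0.12) «averaging decreases the action»); the background enters ONLY through `(m, w′)`, linearly inside the square
(additive shape; the relative shape is false at flat sections, skeleton §2.B).  Proof: the pointwise bound of file 1; Cauchy–Schwarz over the `n^{d+2}` triples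
`(j,t,s)` ∕ `n^{d+1}` pairs `(j,t)`; for each offset the translated block sum is the full fine sum (`sum_blocks_translate`); Minkowski in `ℓ²(Tor M)` for the four
functionals; `Σ_μΣ_ν(a_{μν} + b)² ≤ (√(Σa²) + d·b)²` (`sum_fin_sq_add_le` twice).  In physical units (coarse level `N`, block side `L`, prefactor `N^{2−d}`; the
owner's letters `ScV`∕`SfV`∕`qVV`) this is the curl half of the `hFED` binder of `VariationalVectorForm.vector_pair_bracket_sqrt` with `δ_curl = √2·d·N·(m + L·w′)` —
filed separately (`VariationalVectorFederbushPhys`).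
 * §4a counting: `card_digits`, `sq_sum_fin_le`, `sum_sq_triple_le`, `sum_sq_double_le`, `sqrt_sum_sq_mul`, `invPow_mul_sqrt`,
   `sum_comp_sq_le`; §4b the two theorems; §4c NON-VACUITY: at flat data (`Rc = R′ = T = 1`) the binders hold with `m = w′ = 0` (`misL_flat`, `pathL_flat`)
   and **`curlSq_QvL_le_flat`**: `curlSq 1 (Q_1 W) ≤ n²·curlSq 1 W∕n^d` — the U = 1 theorem for `E`-valued 1-forms, constant exactly 1.
WHAT IS NOT HERE: the `G`-half of (D2)'s form (leaf V-GF), the sizes of `(m, w′)` for contour transports (taxi∕CLASS lineage), the physical-units file.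

HONEST FRAMING (T4-DAG p. 1).  Model level; [folklore] Cauchy–Schwarz + block bijection + Minkowski; nothing printed is a hypothesis; no `def`, no `def … : Prop`,
no `sorry`; axioms standard.  NE2 NOT proved; spine PROVED 0∕9 unchanged; rung (B)+1 finite T⁴ — NOT infinite volume, NOT mass gap, NOT Clay.  HONEST DEPENDENCY
(cell, verbatim): continuum YM on T⁴ ⇐ BetaPertH ∧ nine spine estimates (0/9 proved); BetaPertH ⇐ (D1) ∧ (D4) ∧ CAP+tail; G-an2-4 gates asym, D1 and NE2/3/4.
-/

noncomputable section

namespace Summit.QuantumFields.BalabanUV.T4Continuum.VariationalVectorFederbush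

open Finset
open Literature.MathematicalPhysics.QuantumFieldTheory.Balaban1983to89
open Literature.MathematicalPhysics.QuantumFieldTheory.Balaban1983to89.B5Prop11Plancherel (Tor fine unitVec)
open Literature.MathematicalPhysics.QuantumFieldTheory.Balaban1983to89.B5Block118 (tstep bpt)
open Summit.QuantumFields.BalabanUV.T4Continuum.VariationalCovariantFederbush (sq_sum_le_card_mul sum_blocks_translate sum_sq_add_le sum_fin_sq_add_le)
open Summit.QuantumFields.BalabanUV.T4Continuum.VectorBlockTrialForm (nsqV nsqV_nonneg QvL)
open Summit.QuantumFields.BalabanUV.T4Continuum.VariationalVectorForm (cdV curlV curlSq curlSq_nonneg)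

variable {d : ℕ} {E : Type*} [NormedAddCommGroup E] [NormedSpace ℂ E]
variable (n : ℕ) [NeZero n] (M : Fin d → ℕ) [hM : ∀ μ, NeZero (M μ)]

/-! ## §4a Counting: Cauchy–Schwarz on the block sums, the block bijection, Minkowski -/

section Counting

omit [NeZero n] hM in
/-- the card of the digit cube: `|Fin d → Fin n| = n^d` as a real number. [folklore] -/
theorem card_digits : ((Finset.univ : Finset (Fin d → Fin n)).card : ℝ) = (n : ℝ) ^ d := by
  rw [Finset.card_univ, Fintype.card_fun, Fintype.card_fin, Fintype.card_fin]; push_cast; ring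

omit [NeZero n] hM in
/-- `(Σ_{t<n} a_t)² ≤ n·Σ a_t²` on `Fin n`. [folklore] -/
theorem sq_sum_fin_le (a : Fin n → ℝ) : (∑ t, a t) ^ 2 ≤ n * ∑ t, a t ^ 2 := by
  have h := sq_sum_le_card_mul Finset.univ a
  rwa [Finset.card_univ, Fintype.card_fin] at h

/-- **the square count**: `Σ_y (Σ_j Σ_t Σ_s F(n·y + j + t e_ν + s e_μ))² ≤ n^d·n·n·(n·n·Σ_x F(x)²)` — Cauchy–Schwarz over the `n^{d+2}` triples, then for
each `(t, s)` the translated block sum is the full fine sum (`sum_blocks_translate`). [folklore] -/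
theorem sum_sq_triple_le (F : Tor (fine n M) → ℝ) (μ ν : Fin d) :
    ∑ y : Tor M, (∑ j : Fin d → Fin n, ∑ t : Fin n, ∑ s : Fin n, F (bpt n M y j + tstep (fine n M) ν t + tstep (fine n M) μ s)) ^ 2
      ≤ (n : ℝ) ^ d * n * n * ((n : ℝ) * n * ∑ x, F x ^ 2) := by
  have step : ∀ y : Tor M, (∑ j : Fin d → Fin n, ∑ t : Fin n, ∑ s : Fin n, F (bpt n M y j + tstep (fine n M) ν t + tstep (fine n M) μ s)) ^ 2
      ≤ (n : ℝ) ^ d * n * n * ∑ j : Fin d → Fin n, ∑ t : Fin n, ∑ s : Fin n, F (bpt n M y j + tstep (fine n M) ν t + tstep (fine n M) μ s) ^ 2 := by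
    intro y
    calc _ ≤ (n : ℝ) ^ d * ∑ j : Fin d → Fin n, (∑ t : Fin n, ∑ s : Fin n, F (bpt n M y j + tstep (fine n M) ν t + tstep (fine n M) μ s)) ^ 2 := by
          have h := sq_sum_le_card_mul Finset.univ
            (fun j : Fin d → Fin n => ∑ t : Fin n, ∑ s : Fin n, F (bpt n M y j + tstep (fine n M) ν t + tstep (fine n M) μ s))
          rwa [card_digits] at h
      _ ≤ (n : ℝ) ^ d * ∑ j : Fin d → Fin n, ((n : ℝ) * ∑ t : Fin n, ((n : ℝ) * ∑ s : Fin n,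
            F (bpt n M y j + tstep (fine n M) ν t + tstep (fine n M) μ s) ^ 2)) := by
          gcongr with j _
          refine (sq_sum_fin_le n _).trans (mul_le_mul_of_nonneg_left (sum_le_sum fun t _ => sq_sum_fin_le n _) (Nat.cast_nonneg _))
      _ = _ := by simp only [← mul_sum]; ring
  have per : ∀ (t s : Fin n), ∑ y : Tor M, ∑ j : Fin d → Fin n, F (bpt n M y j + tstep (fine n M) ν t + tstep (fine n M) μ s) ^ 2 = ∑ x, F x ^ 2 := by
    intro t s
    have h := sum_blocks_translate n M (fun x => F x ^ 2) (tstep (fine n M) ν t + tstep (fine n M) μ s)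
    simpa only [add_assoc] using h
  have reorder : ∑ y : Tor M, ∑ j : Fin d → Fin n, ∑ t : Fin n, ∑ s : Fin n, F (bpt n M y j + tstep (fine n M) ν t + tstep (fine n M) μ s) ^ 2
      = ∑ t : Fin n, ∑ s : Fin n, ∑ y : Tor M, ∑ j : Fin d → Fin n, F (bpt n M y j + tstep (fine n M) ν t + tstep (fine n M) μ s) ^ 2 := by
    calc ∑ y : Tor M, ∑ j : Fin d → Fin n, ∑ t : Fin n, ∑ s : Fin n, F (bpt n M y j + tstep (fine n M) ν t + tstep (fine n M) μ s) ^ 2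
        = ∑ y : Tor M, ∑ t : Fin n, ∑ j : Fin d → Fin n, ∑ s : Fin n, F (bpt n M y j + tstep (fine n M) ν t + tstep (fine n M) μ s) ^ 2 :=
          sum_congr rfl fun y _ => Finset.sum_comm
      _ = ∑ t : Fin n, ∑ y : Tor M, ∑ j : Fin d → Fin n, ∑ s : Fin n, F (bpt n M y j + tstep (fine n M) ν t + tstep (fine n M) μ s) ^ 2 :=
          Finset.sum_comm
      _ = ∑ t : Fin n, ∑ y : Tor M, ∑ s : Fin n, ∑ j : Fin d → Fin n, F (bpt n M y j + tstep (fine n M) ν t + tstep (fine n M) μ s) ^ 2 :=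
          sum_congr rfl fun t _ => sum_congr rfl fun y _ => Finset.sum_comm
      _ = _ := sum_congr rfl fun t _ => Finset.sum_comm
  calc _ ≤ ∑ y : Tor M, (n : ℝ) ^ d * n * n * ∑ j : Fin d → Fin n, ∑ t : Fin n, ∑ s : Fin n,
          F (bpt n M y j + tstep (fine n M) ν t + tstep (fine n M) μ s) ^ 2 := sum_le_sum fun y _ => step y
    _ = (n : ℝ) ^ d * n * n * ∑ t : Fin n, ∑ s : Fin n, ∑ y : Tor M, ∑ j : Fin d → Fin n,
          F (bpt n M y j + tstep (fine n M) ν t + tstep (fine n M) μ s) ^ 2 := by rw [← mul_sum, reorder]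
    _ = _ := by simp only [per, sum_const, Finset.card_univ, Fintype.card_fin, nsmul_eq_mul]; ring

/-- **the line count**: `Σ_y (Σ_j Σ_t G(n·y + j + t e_ν + v))² ≤ n^d·n·(n·Σ_x G(x)²)` (any fixed offset `v`). [folklore] -/
theorem sum_sq_double_le (G : Tor (fine n M) → ℝ) (ν : Fin d) (v : Tor (fine n M)) :
    ∑ y : Tor M, (∑ j : Fin d → Fin n, ∑ t : Fin n, G (bpt n M y j + tstep (fine n M) ν t + v)) ^ 2
      ≤ (n : ℝ) ^ d * n * ((n : ℝ) * ∑ x, G x ^ 2) := by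
  have step : ∀ y : Tor M, (∑ j : Fin d → Fin n, ∑ t : Fin n, G (bpt n M y j + tstep (fine n M) ν t + v)) ^ 2
      ≤ (n : ℝ) ^ d * n * ∑ j : Fin d → Fin n, ∑ t : Fin n, G (bpt n M y j + tstep (fine n M) ν t + v) ^ 2 := by
    intro y
    calc _ ≤ (n : ℝ) ^ d * ∑ j : Fin d → Fin n, (∑ t : Fin n, G (bpt n M y j + tstep (fine n M) ν t + v)) ^ 2 := by
          have h := sq_sum_le_card_mul Finset.univ (fun j : Fin d → Fin n => ∑ t : Fin n, G (bpt n M y j + tstep (fine n M) ν t + v))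
          rwa [card_digits] at h
      _ ≤ (n : ℝ) ^ d * ∑ j : Fin d → Fin n, ((n : ℝ) * ∑ t : Fin n, G (bpt n M y j + tstep (fine n M) ν t + v) ^ 2) := by
          gcongr with j _
          exact sq_sum_fin_le n _
      _ = _ := by simp only [← mul_sum]; ring
  have per : ∀ t : Fin n, ∑ y : Tor M, ∑ j : Fin d → Fin n, G (bpt n M y j + tstep (fine n M) ν t + v) ^ 2 = ∑ x, G x ^ 2 := by
    intro t
    have h := sum_blocks_translate n M (fun x => G x ^ 2) (tstep (fine n M) ν t + v)
    simpa only [add_assoc] using h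
  have reorder : ∑ y : Tor M, ∑ j : Fin d → Fin n, ∑ t : Fin n, G (bpt n M y j + tstep (fine n M) ν t + v) ^ 2
      = ∑ t : Fin n, ∑ y : Tor M, ∑ j : Fin d → Fin n, G (bpt n M y j + tstep (fine n M) ν t + v) ^ 2 := by
    calc ∑ y : Tor M, ∑ j : Fin d → Fin n, ∑ t : Fin n, G (bpt n M y j + tstep (fine n M) ν t + v) ^ 2
        = ∑ y : Tor M, ∑ t : Fin n, ∑ j : Fin d → Fin n, G (bpt n M y j + tstep (fine n M) ν t + v) ^ 2 :=
          sum_congr rfl fun y _ => Finset.sum_comm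
      _ = _ := Finset.sum_comm
  calc _ ≤ ∑ y : Tor M, (n : ℝ) ^ d * n * ∑ j : Fin d → Fin n, ∑ t : Fin n, G (bpt n M y j + tstep (fine n M) ν t + v) ^ 2 :=
        sum_le_sum fun y _ => step y
    _ = (n : ℝ) ^ d * n * ∑ t : Fin n, ∑ y : Tor M, ∑ j : Fin d → Fin n, G (bpt n M y j + tstep (fine n M) ν t + v) ^ 2 := by
        rw [← mul_sum, reorder]
    _ = _ := by simp only [per, sum_const, Finset.card_univ, Fintype.card_fin, nsmul_eq_mul]

omit [NeZero n] hM in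
/-- `√(Σ (c·A)²) = c·√(Σ A²)` for `c ≥ 0`. [folklore] -/
theorem sqrt_sum_sq_mul {ι : Type*} (s : Finset ι) (A : ι → ℝ) {c : ℝ} (hc : 0 ≤ c) :
    Real.sqrt (∑ i ∈ s, (c * A i) ^ 2) = c * Real.sqrt (∑ i ∈ s, A i ^ 2) := by
  have e : ∑ i ∈ s, (c * A i) ^ 2 = c ^ 2 * ∑ i ∈ s, A i ^ 2 := by rw [mul_sum]; exact sum_congr rfl fun i _ => by ring
  rw [e, Real.sqrt_mul (sq_nonneg c), Real.sqrt_sq hc]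

omit hM in
/-- moving the averaging prefactor inside the roots: `(n^{d+1})⁻¹·√(n^d·n·n·(n·n·Z)) = √(n²·Z∕n^d)` and `(n^{d+1})⁻¹·√(n^d·n·(n·Z)) = √(Z∕n^d)`. [folklore] -/
theorem invPow_mul_sqrt (Z : ℝ) :
    ((n : ℝ) ^ (d + 1))⁻¹ * Real.sqrt ((n : ℝ) ^ d * n * n * ((n : ℝ) * n * Z)) = Real.sqrt ((n : ℝ) ^ 2 * Z / (n : ℝ) ^ d) ∧
      ((n : ℝ) ^ (d + 1))⁻¹ * Real.sqrt ((n : ℝ) ^ d * n * ((n : ℝ) * Z)) = Real.sqrt (Z / (n : ℝ) ^ d) := by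
  have hn : (n : ℝ) ≠ 0 := by exact_mod_cast NeZero.ne n
  have hc : 0 ≤ ((n : ℝ) ^ (d + 1))⁻¹ := by positivity
  have key : ∀ X : ℝ, ((n : ℝ) ^ (d + 1))⁻¹ * Real.sqrt X = Real.sqrt ((((n : ℝ) ^ (d + 1))⁻¹) ^ 2 * X) := fun X => by
    rw [Real.sqrt_mul (sq_nonneg _), Real.sqrt_sq hc]
  refine ⟨?_, ?_⟩
  · rw [key]; congr 1; field_simp; ring
  · rw [key]; congr 1; field_simp; ring

variable {Rc : Tor M → Fin d → (E →L[ℂ] E)} {R' : Tor (fine n M) → Fin d → (E →L[ℂ] E)}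
  {T : Tor M → (Fin d → Fin n) → Fin n → Fin d → (E →L[ℂ] E)}

omit [NormedSpace ℂ E] in
/-- a component's `ℓ²` size is at most the 1-form's, also after a translation: `Σ_x ‖W(x + v, μ)‖² ≤ Σ_{x,μ}‖W(x,μ)‖²`. [folklore] -/
theorem sum_comp_sq_le (W : Tor (fine n M) → Fin d → E) (v : Tor (fine n M)) (μ : Fin d) :
    ∑ x, ‖W (x + v) μ‖ ^ 2 ≤ nsqV (fine n M) W := by
  rw [Fintype.sum_equiv (Equiv.addRight v) (fun x => ‖W (x + v) μ‖ ^ 2) (fun x => ‖W x μ‖ ^ 2) fun x => rfl]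
  exact sum_le_sum fun x _ => Finset.single_le_sum (f := fun μ => ‖W x μ‖ ^ 2) (fun _ _ => by positivity) (Finset.mem_univ μ)

/-! ## §4b The two theorems -/

/-- **LEAF V-FED PER PLANE (lattice units): THE COVARIANT FEDERBUSH INEQUALITY FOR THE CURL, ADDITIVE FORM** — one block step of side `n`, every torus,
every normed ℂ-space `E`, every fine 1-form `W`, every ordered plane `(μ, ν)`; contractive `R′`, `T`; (M1) `‖Mis‖ ≤ m`; (M2) `‖A − B‖ ≤ w′`:
`Σ_y ‖curl_{Rc}(Q_T W)(y,μ,ν)‖² ≤ ( √(n²·C′_{μν}∕n^d) + (2m + 2n·w′)·√(Y∕n^d) )²`, `C′_{μν} = Σ_x‖curl_{R′}W(x,μ,ν)‖²`, `Y = Σ_{x,μ}‖W(x,μ)‖²`.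
MAIN TERM CONSTANT EXACTLY 1; the background enters only through `(m, w′)`. [folklore] -/
theorem sum_sq_curlV_QvL_le (hR' : ∀ x μ, ‖R' x μ‖ ≤ 1) (hT : ∀ y j t μ, ‖T y j t μ‖ ≤ 1) {m w' : ℝ} (hm : 0 ≤ m) (hw' : 0 ≤ w')
    (hmis : ∀ y j t μ ν, ‖misL n M Rc R' T y j t μ ν‖ ≤ m)
    (hpath : ∀ y j s t μ ν, ‖pathL n M R' T y j s t μ ν - pathL n M R' T y j t s ν μ‖ ≤ w')
    (W : Tor (fine n M) → Fin d → E) (μ ν : Fin d) :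
    ∑ y, ‖curlV M Rc (QvL n M T W) y μ ν‖ ^ 2
      ≤ (Real.sqrt ((n : ℝ) ^ 2 * (∑ x, ‖curlV (fine n M) R' W x μ ν‖ ^ 2) / (n : ℝ) ^ d)
          + (2 * m + 2 * n * w') * Real.sqrt (nsqV (fine n M) W / (n : ℝ) ^ d)) ^ 2 := by
  have hn : (0 : ℝ) < n := by exact_mod_cast Nat.pos_of_ne_zero (NeZero.ne n)
  set c : ℝ := ((n : ℝ) ^ (d + 1))⁻¹ with hc
  have hc0 : 0 ≤ c := by positivity
  -- the four nonnegative block functionals of the pointwise bound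
  set FA : Tor M → ℝ := fun y => ∑ j : Fin d → Fin n, ∑ t : Fin n, ∑ s : Fin n,
    ‖curlV (fine n M) R' W (bpt n M y j + tstep (fine n M) ν t + tstep (fine n M) μ s) μ ν‖ with hFA
  set FB : Tor M → ℝ := fun y => ∑ j : Fin d → Fin n, ∑ t : Fin n, ∑ s : Fin n,
    (‖W (bpt n M y j + tstep (fine n M) ν t + tstep (fine n M) μ s + unitVec (fine n M) ν) μ‖
      + ‖W (bpt n M y j + tstep (fine n M) ν t + tstep (fine n M) μ s) μ‖) with hFB
  set FC : Tor M → ℝ := fun y => ∑ j : Fin d → Fin n, ∑ t : Fin n, ‖W (bpt n M y j + tstep (fine n M) ν t + tstep (fine n M) μ n) ν‖ with hFC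
  set FD : Tor M → ℝ := fun y => ∑ j : Fin d → Fin n, ∑ s : Fin n, ‖W (bpt n M y j + tstep (fine n M) μ s + tstep (fine n M) ν n) μ‖ with hFD
  have hpt : ∀ y, ‖curlV M Rc (QvL n M T W) y μ ν‖ ≤ c * (FA y + (w' * FB y + (m * FC y + m * FD y))) := by
    intro y
    have h := norm_curlV_QvL_le n M hR' hT hmis hpath W y μ ν
    refine h.trans (le_of_eq ?_)
    simp only [hFA, hFB, hFC, hFD, hc, sum_add_distrib, ← Finset.mul_sum]
    ring
  -- squares and Minkowski
  set Y : ℝ := nsqV (fine n M) W with hY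
  have hY0 : 0 ≤ Y := nsqV_nonneg _ W
  have hsq : ∀ y, ‖curlV M Rc (QvL n M T W) y μ ν‖ ^ 2 ≤ c ^ 2 * (FA y + (w' * FB y + (m * FC y + m * FD y))) ^ 2 := fun y => by
    rw [← mul_pow]; exact pow_le_pow_left₀ (norm_nonneg _) (hpt y) 2
  -- finite Minkowski in `ℓ²(Tor M)`: the scalar leaf's `sum_sq_add_le` at `m = 1`, square-rooted
  have mink : ∀ A B : Tor M → ℝ, Real.sqrt (∑ y, (A y + B y) ^ 2) ≤ Real.sqrt (∑ y, A y ^ 2) + Real.sqrt (∑ y, B y ^ 2) := by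
    intro A B
    have h := sum_sq_add_le Finset.univ A B zero_le_one
    simp only [one_mul] at h
    have h0 : 0 ≤ Real.sqrt (∑ y, A y ^ 2) + Real.sqrt (∑ y, B y ^ 2) := by positivity
    exact (Real.sqrt_le_sqrt h).trans (le_of_eq (Real.sqrt_sq h0))
  have hmink : Real.sqrt (∑ y, (FA y + (w' * FB y + (m * FC y + m * FD y))) ^ 2)
      ≤ Real.sqrt (∑ y, FA y ^ 2) + (w' * Real.sqrt (∑ y, FB y ^ 2) + (m * Real.sqrt (∑ y, FC y ^ 2) + m * Real.sqrt (∑ y, FD y ^ 2))) := by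
    refine (mink _ _).trans (add_le_add le_rfl ?_)
    refine (mink _ _).trans (add_le_add (le_of_eq (sqrt_sum_sq_mul _ _ hw')) ?_)
    exact (mink _ _).trans (add_le_add (le_of_eq (sqrt_sum_sq_mul _ _ hm)) (le_of_eq (sqrt_sum_sq_mul _ _ hm)))
  -- the four counts
  have hY1 : ∀ κ : Fin d, ∑ x, ‖W x κ‖ ^ 2 ≤ Y := fun κ => by
    have h := sum_comp_sq_le n M W 0 κ
    simp only [add_zero] at h
    exact h
  have hA : ∑ y, FA y ^ 2 ≤ (n : ℝ) ^ d * n * n * ((n : ℝ) * n * ∑ x, ‖curlV (fine n M) R' W x μ ν‖ ^ 2) :=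
    sum_sq_triple_le n M (fun x => ‖curlV (fine n M) R' W x μ ν‖) μ ν
  have hB : ∑ y, FB y ^ 2 ≤ (n : ℝ) ^ d * n * n * ((n : ℝ) * n * (4 * Y)) := by
    refine (sum_sq_triple_le n M (fun x => ‖W (x + unitVec (fine n M) ν) μ‖ + ‖W x μ‖) μ ν).trans ?_
    have h1 := sum_comp_sq_le n M W (unitVec (fine n M) ν) μ
    have h2 := hY1 μ
    have h4 : ∑ x, (‖W (x + unitVec (fine n M) ν) μ‖ + ‖W x μ‖) ^ 2 ≤ 4 * Y := by
      calc _ ≤ ∑ x, (2 * ‖W (x + unitVec (fine n M) ν) μ‖ ^ 2 + 2 * ‖W x μ‖ ^ 2) :=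
            sum_le_sum fun x _ => by nlinarith [sq_nonneg (‖W (x + unitVec (fine n M) ν) μ‖ - ‖W x μ‖)]
        _ = 2 * ∑ x, ‖W (x + unitVec (fine n M) ν) μ‖ ^ 2 + 2 * ∑ x, ‖W x μ‖ ^ 2 := by rw [sum_add_distrib, mul_sum, mul_sum]
        _ ≤ 4 * Y := by linarith
    gcongr
  have hC : ∑ y, FC y ^ 2 ≤ (n : ℝ) ^ d * n * ((n : ℝ) * Y) := by
    refine (sum_sq_double_le n M (fun x => ‖W x ν‖) ν (tstep (fine n M) μ n)).trans ?_
    have := hY1 ν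
    gcongr
  have hD : ∑ y, FD y ^ 2 ≤ (n : ℝ) ^ d * n * ((n : ℝ) * Y) := by
    refine (sum_sq_double_le n M (fun x => ‖W x μ‖) μ (tstep (fine n M) ν n)).trans ?_
    have := hY1 μ
    gcongr
  -- assemble
  obtain ⟨e1, e2⟩ := invPow_mul_sqrt n (d := d) Y
  obtain ⟨e3, -⟩ := invPow_mul_sqrt n (d := d) (∑ x, ‖curlV (fine n M) R' W x μ ν‖ ^ 2)
  have e4 : Real.sqrt ((n : ℝ) ^ d * n * n * ((n : ℝ) * n * (4 * Y))) = 2 * n * Real.sqrt ((n : ℝ) ^ d * n * ((n : ℝ) * Y)) := by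
    have e : (n : ℝ) ^ d * n * n * ((n : ℝ) * n * (4 * Y)) = (2 * n) ^ 2 * ((n : ℝ) ^ d * n * ((n : ℝ) * Y)) := by ring
    rw [e, Real.sqrt_mul (sq_nonneg _), Real.sqrt_sq (by positivity)]
  have hl : 0 ≤ Real.sqrt (∑ y, FA y ^ 2) + (w' * Real.sqrt (∑ y, FB y ^ 2) + (m * Real.sqrt (∑ y, FC y ^ 2) + m * Real.sqrt (∑ y, FD y ^ 2))) := by
    positivity
  have hS0 : 0 ≤ ∑ y, (FA y + (w' * FB y + (m * FC y + m * FD y))) ^ 2 := sum_nonneg fun _ _ => sq_nonneg _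
  calc ∑ y, ‖curlV M Rc (QvL n M T W) y μ ν‖ ^ 2
      ≤ ∑ y, c ^ 2 * (FA y + (w' * FB y + (m * FC y + m * FD y))) ^ 2 := sum_le_sum fun y _ => hsq y
    _ = c ^ 2 * Real.sqrt (∑ y, (FA y + (w' * FB y + (m * FC y + m * FD y))) ^ 2) ^ 2 := by rw [← mul_sum, Real.sq_sqrt hS0]
    _ ≤ c ^ 2 * (Real.sqrt (∑ y, FA y ^ 2) + (w' * Real.sqrt (∑ y, FB y ^ 2) + (m * Real.sqrt (∑ y, FC y ^ 2) + m * Real.sqrt (∑ y, FD y ^ 2)))) ^ 2 :=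
        mul_le_mul_of_nonneg_left (pow_le_pow_left₀ (Real.sqrt_nonneg _) hmink 2) (sq_nonneg _)
    _ ≤ c ^ 2 * (Real.sqrt ((n : ℝ) ^ d * n * n * ((n : ℝ) * n * ∑ x, ‖curlV (fine n M) R' W x μ ν‖ ^ 2))
          + (w' * Real.sqrt ((n : ℝ) ^ d * n * n * ((n : ℝ) * n * (4 * Y)))
            + (m * Real.sqrt ((n : ℝ) ^ d * n * ((n : ℝ) * Y)) + m * Real.sqrt ((n : ℝ) ^ d * n * ((n : ℝ) * Y))))) ^ 2 := by
        refine mul_le_mul_of_nonneg_left (pow_le_pow_left₀ hl ?_ 2) (sq_nonneg _)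
        gcongr
    _ = (c * Real.sqrt ((n : ℝ) ^ d * n * n * ((n : ℝ) * n * ∑ x, ‖curlV (fine n M) R' W x μ ν‖ ^ 2))
          + (2 * m + 2 * n * w') * (c * Real.sqrt ((n : ℝ) ^ d * n * ((n : ℝ) * Y)))) ^ 2 := by rw [e4]; ring
    _ = _ := by rw [e3, e2]

/-- **LEAF V-FED (lattice units): THE CURL FORM OF THE TRANSPORTED AVERAGE AGAINST THE FINE CURL FORM, ADDITIVE** — summed over ordered planes:
`curlSq Rc (Q_T W) ≤ ( √(n²·curlSq R′ W∕n^d) + d·(2m + 2n·w′)·√(Y∕n^d) )²`.  In physical units at coarse level `N = L^k` (block side `n := L`,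
prefactor `N^{2−d}`, see `VariationalVectorFederbushPhys`): `½N^{2−d}curlSq(Q W′) ≤ (√(½(NL)^{2−d}curlSq′ W′) + √2·d·N·(m + L w′)·‖W′‖_{ℓ²,phys})²` —
the curl half of the `hFED` binder of `VariationalVectorForm.vector_pair_bracket_sqrt`. [folklore] -/
theorem curlSq_QvL_le (hR' : ∀ x μ, ‖R' x μ‖ ≤ 1) (hT : ∀ y j t μ, ‖T y j t μ‖ ≤ 1) {m w' : ℝ} (hm : 0 ≤ m) (hw' : 0 ≤ w')
    (hmis : ∀ y j t μ ν, ‖misL n M Rc R' T y j t μ ν‖ ≤ m)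
    (hpath : ∀ y j s t μ ν, ‖pathL n M R' T y j s t μ ν - pathL n M R' T y j t s ν μ‖ ≤ w')
    (W : Tor (fine n M) → Fin d → E) :
    curlSq M Rc (QvL n M T W)
      ≤ (Real.sqrt ((n : ℝ) ^ 2 * curlSq (fine n M) R' W / (n : ℝ) ^ d)
          + d * ((2 * m + 2 * n * w') * Real.sqrt (nsqV (fine n M) W / (n : ℝ) ^ d))) ^ 2 := by
  have hnd : (0 : ℝ) < (n : ℝ) ^ d := by have := Nat.pos_of_ne_zero (NeZero.ne n); positivity
  set b : ℝ := (2 * m + 2 * n * w') * Real.sqrt (nsqV (fine n M) W / (n : ℝ) ^ d) with hb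
  have hb0 : 0 ≤ b := by positivity
  set a : Fin d → Fin d → ℝ := fun μ ν => Real.sqrt ((n : ℝ) ^ 2 * (∑ x, ‖curlV (fine n M) R' W x μ ν‖ ^ 2) / (n : ℝ) ^ d) with ha
  have ha2 : ∀ μ ν, a μ ν ^ 2 = (n : ℝ) ^ 2 * (∑ x, ‖curlV (fine n M) R' W x μ ν‖ ^ 2) / (n : ℝ) ^ d := fun μ ν =>
    Real.sq_sqrt (div_nonneg (mul_nonneg (sq_nonneg _) (sum_nonneg fun _ _ => sq_nonneg _)) hnd.le)
  -- reorder the coarse sum: planes outside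
  have hswap : curlSq M Rc (QvL n M T W) = ∑ μ, ∑ ν, ∑ y, ‖curlV M Rc (QvL n M T W) y μ ν‖ ^ 2 := by
    unfold curlSq
    rw [Finset.sum_comm]
    exact sum_congr rfl fun μ _ => Finset.sum_comm
  have hcomm : (∑ μ, ∑ ν, ∑ x, ‖curlV (fine n M) R' W x μ ν‖ ^ 2) = ∑ x, ∑ μ, ∑ ν, ‖curlV (fine n M) R' W x μ ν‖ ^ 2 := by
    calc (∑ μ, ∑ ν, ∑ x, ‖curlV (fine n M) R' W x μ ν‖ ^ 2) = ∑ μ, ∑ x, ∑ ν, ‖curlV (fine n M) R' W x μ ν‖ ^ 2 :=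
          sum_congr rfl fun μ _ => Finset.sum_comm
      _ = _ := Finset.sum_comm
  have hfine : ∑ μ, ∑ ν, a μ ν ^ 2 = (n : ℝ) ^ 2 * curlSq (fine n M) R' W / (n : ℝ) ^ d := by
    simp only [ha2, ← Finset.sum_div, ← Finset.mul_sum, hcomm, curlSq]
  have hd2 : Real.sqrt d * (Real.sqrt d * b) = d * b := by
    rw [← mul_assoc, Real.mul_self_sqrt (Nat.cast_nonneg d)]
  rw [hswap]
  calc ∑ μ, ∑ ν, ∑ y, ‖curlV M Rc (QvL n M T W) y μ ν‖ ^ 2 ≤ ∑ μ, ∑ ν, (a μ ν + b) ^ 2 :=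
        sum_le_sum fun μ _ => sum_le_sum fun ν _ => sum_sq_curlV_QvL_le n M hR' hT hm hw' hmis hpath W μ ν
    _ ≤ ∑ μ, (Real.sqrt (∑ ν, a μ ν ^ 2) + Real.sqrt d * b) ^ 2 := sum_le_sum fun μ _ => sum_fin_sq_add_le (a μ) hb0
    _ ≤ (Real.sqrt (∑ μ, Real.sqrt (∑ ν, a μ ν ^ 2) ^ 2) + Real.sqrt d * (Real.sqrt d * b)) ^ 2 :=
        sum_fin_sq_add_le (fun μ => Real.sqrt (∑ ν, a μ ν ^ 2)) (by positivity)
    _ = (Real.sqrt (∑ μ, ∑ ν, a μ ν ^ 2) + d * b) ^ 2 := by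
        rw [hd2]
        congr 3
        exact sum_congr rfl fun μ _ => Real.sq_sqrt (sum_nonneg fun _ _ => sq_nonneg _)
    _ = _ := by rw [hfine]

/-! ## §4c Flat data: the hypotheses hold with `m = w′ = 0` and the U = 1 Federbush inequality with constant exactly 1 comes out -/

omit [NeZero n] hM in
/-- the straight transporter of identity bond maps is the identity. [folklore] -/
theorem piTv_one (x : Tor (fine n M)) (μ : Fin d) (t : ℕ) :
    VariationalColourFederbush.piTv n M (fun _ _ => (1 : E →L[ℂ] E)) x μ t = 1 := by
  induction t with
  | zero => rfl
  | succ t ih => simp only [VariationalColourFederbush.piTv, ih, mul_one]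

omit [NeZero n] hM in
/-- flat data: the across-block line mismatch vanishes. [folklore] -/
theorem misL_flat (y : Tor M) (j : Fin d → Fin n) (t : Fin n) (μ ν : Fin d) :
    misL n M (fun _ _ => (1 : E →L[ℂ] E)) (fun _ _ => 1) (fun _ _ _ _ => 1) y j t μ ν = 0 := by
  simp only [misL, piTv_one, mul_one, sub_self]

omit [NeZero n] hM in
/-- flat data: the comb transports are the identity. [folklore] -/
theorem pathL_flat (y : Tor M) (j : Fin d → Fin n) (s t : Fin n) (μ ν : Fin d) :
    pathL n M (fun _ _ => (1 : E →L[ℂ] E)) (fun _ _ _ _ => 1) y j s t μ ν = 1 := by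
  simp only [pathL, piTv_one, mul_one]

/-- **NON-VACUITY ∕ THE U = 1 INSTANCE**: at flat data (all transports the identity) the binders hold with `m = w′ = 0` and `curlSq_QvL_le` reads
`curlSq 1 (Q_1 W) ≤ n²·curlSq 1 W ∕ n^d` — Federbush's «averaging decreases the action» for `E`-valued 1-forms, constant EXACTLY 1 (the tree's
`B5AverageCurlStokes.sum_normSq_plaq_QvOp_le` is the case `E = ℂ`). [folklore] -/
theorem curlSq_QvL_le_flat (W : Tor (fine n M) → Fin d → E) :
    curlSq M (fun _ _ => (1 : E →L[ℂ] E)) (QvL n M (fun _ _ _ _ => (1 : E →L[ℂ] E)) W)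
      ≤ (n : ℝ) ^ 2 * curlSq (fine n M) (fun _ _ => (1 : E →L[ℂ] E)) W / (n : ℝ) ^ d := by
  have hX : 0 ≤ (n : ℝ) ^ 2 * curlSq (fine n M) (fun _ _ => (1 : E →L[ℂ] E)) W / (n : ℝ) ^ d := by
    have := curlSq_nonneg (fine n M) (fun _ _ => (1 : E →L[ℂ] E)) W
    positivity
  have h := curlSq_QvL_le n M (Rc := fun _ _ => (1 : E →L[ℂ] E)) (R' := fun _ _ => 1) (T := fun _ _ _ _ => 1)
    (fun _ _ => ContinuousLinearMap.norm_id_le) (fun _ _ _ _ => ContinuousLinearMap.norm_id_le) le_rfl le_rfl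
    (fun y j t μ ν => by rw [misL_flat, norm_zero]) (fun y j s t μ ν => by rw [pathL_flat, pathL_flat, sub_self, norm_zero]) W
  simpa only [mul_zero, add_zero, zero_mul, Real.sq_sqrt hX] using h

end Counting

end Summit.QuantumFields.BalabanUV.T4Continuum.VariationalVectorFederbush

end
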